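import Mathlib
import Summits.ValiantsHypothesis.ValiantsHypothesis.Theorems.BarrierLeverPartitionMinorsHitByVPHiddenStatesGradedColex
import Summits.ValiantsHypothesis.ValiantsHypothesis.Theorems.BarrierLeverPartitionMinorsHitByVPHiddenStatesSupports

/-!
# Route BarrierLever — item `PartitionMinorsHitByVP` (stmt-ValiantsHypothesis-19717), line `hidden-states`:
# GC½ AT THE EXACT HALF SERVES THE SUBCUBE, FOR EVERY `h` — the antipodal support bijection for the graded-colex family

Helper file (`--supports stmt-ValiantsHypothesis-19717`; cell valiant-natproofs, rung V4, 𝒟-side door (c), registered line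
`Cruxes/PartitionMinorsHitByVP/Lines/hidden_states.lean` v8; prover seat val-np-p6 gen 14). Definition-free; closes NO item.

Conjecture GC½ (the hypothesis `H` of `BallDiag.universalJoinWideLower_upperHalf_of_gc`, p636831) says: for `2^{h−1} ≤ r ≤ 2^h` the
ONE-PIECE graded-colex threshold family of size `r` on `K = h` states serves every lower row family of size `r`. Its instance
«`r = 2^{h−1}`, row family = a SUBCUBE `{S : x ∉ S}`» was a kernel theorem for ODD `h` only (`symGood_halfBall_cube`, p590044: there the
family is the middle ball `B_t(2t+1)`). This file proves it for EVERY `h = n + 1`, directly for the ABSTRACT graded-colex family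
(any injective `cols : Fin (2^n) → Finset (Fin (n+1))` with the strict-threshold property for the weights `2^{n+1} + 2^q`).

THE POINT. Write `z` for the top state. A graded-colex family of size `2^n` is an initial segment of the weight order, so
(`card_le_of_mem`, `card_le_of_mem_top`): every member has at most `⌊h/2⌋` states and every member containing `z` has at most `⌊n/2⌋`
(both by the counting lemma `two_pow_le_two_mul_card`: a family containing `J` or its complement for every `J` has at least `2^{h−1}`
members). ANTIPODAL TABLE: base `0`, state `q ≠ z ↦ e_{σ q}` (`σ` = the order isomorphism onto the coordinates `≠ x`), `z ↦ −Σ e_{σ q}`.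
The hidden point of a member `J ∌ z` is the indicator of `σ(J)`; of a member `J ∋ z` it is MINUS the indicator of the complement of
`σ(J ∖ z)` inside the coordinates `≠ x`. The supports are pairwise distinct (sizes `≤ ⌊h/2⌋` versus `≥ ⌊h/2⌋ + 1` across the two classes)
and avoid `x`, hence — `2^n` of them — they are exactly the rows: `det ≠ 0` by the support-bijection lemma (`TwoLayer`-style triangularity,
`SymbJoin.det_ne_zero_of_supports`, p592799).

* `two_pow_le_two_mul_card`, `gc_mem_of_lt`, `card_le_of_mem`, `card_le_of_mem_top` — structure of the half graded-colex family.
* **`gc_half_serves_subcube`** — the GC½ instance: `h = n + 1`, `r = 2^n`, ANY graded-colex `cols`, ANY injective `u` avoiding a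
  coordinate `x` (then `u` enumerates the subcube), explicit table.
* `gc_hypothesis_half_subcube` — the same in the exact binder shape of the GC½ hypothesis (`h ≥ 1`, `r = 2^{h−1}`).

WHAT THIS IS NOT: one row family (the subcube, up to symmetry) at one size per `h`; GC½ itself (all lower families, all
`r ≥ 2^{h−1}`) stays a conjecture (census this seat: h = 11..15 exact half, structured extremal families, 0 bad); nothing on crux 14610
or VP ≠ VNP.
-/

set_option linter.dupNamespace false

namespace Summit.ValiantsHypothesis.ValiantsHypothesis.Theorems.BarrierLever.HiddenStates

open Finset

noncomputable section

namespace BallDiag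

/-! ## 1. The half graded-colex family: members are small -/

/-- **Counting lemma.** A family of subsets of `Fin h` containing, for every `J`, either `J` or its complement has at least `2^{h−1}`
members: `2^h ≤ 2 |L|`. -/
theorem two_pow_le_two_mul_card (h : ℕ) (L : Finset (Finset (Fin h))) (hL : ∀ J : Finset (Fin h), J ∈ L ∨ Jᶜ ∈ L) :
    2 ^ h ≤ 2 * L.card := by
  classical
  have hsub : (Finset.univ : Finset (Finset (Fin h))) ⊆ L ∪ L.image compl := by
    intro J _
    rcases hL J with hJ | hJ
    · exact Finset.mem_union_left _ hJ
    · exact Finset.mem_union_right _ (Finset.mem_image.mpr ⟨Jᶜ, hJ, compl_compl J⟩)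
  have h1 := Finset.card_le_card hsub
  rw [Finset.card_univ, Fintype.card_finset, Fintype.card_fin] at h1
  have h2 := Finset.card_union_le L (L.image compl)
  have h3 : (L.image compl).card ≤ L.card := Finset.card_image_le
  omega

/-- The binary part of the weight of a set avoiding the top state is below `2^n`. -/
theorem binSum_lt_of_notMem_last (n : ℕ) (J : Finset (Fin (n + 1))) (hJ : Fin.last n ∉ J) :
    ∑ q ∈ J, 2 ^ (q : ℕ) < 2 ^ n := by
  have h1 : ∑ q ∈ J, 2 ^ (q : ℕ) = ∑ k ∈ J.map Fin.valEmbedding, 2 ^ k := by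
    rw [Finset.sum_map]; rfl
  rw [h1]
  refine Nat.geomSum_lt le_rfl fun k hk => ?_
  obtain ⟨q, hq, rfl⟩ := Finset.mem_map.mp hk
  have hqz : q ≠ Fin.last n := fun h => hJ (h ▸ hq)
  exact Fin.val_lt_last hqz

/-- **A graded-colex family is an initial segment of the weight order**: anything strictly lighter than a member is a member. -/
theorem gc_mem_of_lt {h r : ℕ} (cols : Fin r → Finset (Fin h))
    (hgc : ∀ k J, J ∉ Set.range cols → ∑ q ∈ cols k, (2 ^ h + 2 ^ (q : ℕ)) < ∑ q ∈ J, (2 ^ h + 2 ^ (q : ℕ)))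
    (k : Fin r) (J : Finset (Fin h)) (hlt : ∑ q ∈ J, (2 ^ h + 2 ^ (q : ℕ)) < ∑ q ∈ cols k, (2 ^ h + 2 ^ (q : ℕ))) :
    J ∈ Set.range cols := by
  by_contra hJ
  have := hgc k J hJ
  omega

/-- **Members of the half family have at most `⌊h/2⌋` states** (`h = n + 1`, `r = 2^n`). -/
theorem card_le_of_mem (n : ℕ) (cols : Fin (2 ^ n) → Finset (Fin (n + 1))) (hinj : Function.Injective cols)
    (hgc : ∀ k J, J ∉ Set.range cols →
      ∑ q ∈ cols k, (2 ^ (n + 1) + 2 ^ (q : ℕ)) < ∑ q ∈ J, (2 ^ (n + 1) + 2 ^ (q : ℕ)))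
    (k : Fin (2 ^ n)) : (cols k).card ≤ (n + 1) / 2 := by
  classical
  by_contra hbig
  push Not at hbig
  set L : Finset (Finset (Fin (n + 1))) := Finset.univ.filter fun J => J.card ≤ (n + 1) / 2 with hLdef
  have hL : ∀ J : Finset (Fin (n + 1)), J ∈ L ∨ Jᶜ ∈ L := by
    intro J
    simp only [hLdef, Finset.mem_filter, Finset.mem_univ, true_and, Finset.card_compl, Fintype.card_fin]
    omega
  have hcount := two_pow_le_two_mul_card (n + 1) L hL
  -- every member of `L` is lighter than `cols k`, hence a column; so is `cols k ∉ L`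
  have hsub : insert (cols k) L ⊆ Finset.univ.image cols := by
    intro J hJ
    rw [Finset.mem_insert] at hJ
    rcases hJ with rfl | hJ
    · exact Finset.mem_image.mpr ⟨k, Finset.mem_univ _, rfl⟩
    · have hJc : J.card < (cols k).card := by
        have := (Finset.mem_filter.mp hJ).2; omega
      obtain ⟨k', hk'⟩ := gc_mem_of_lt cols hgc k J (gcw_lt_of_card_lt (n + 1) J (cols k) hJc)
      exact Finset.mem_image.mpr ⟨k', Finset.mem_univ _, hk'⟩
  have hnot : cols k ∉ L := by
    intro hk; have := (Finset.mem_filter.mp hk).2; omega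
  have h1 := Finset.card_le_card hsub
  rw [Finset.card_insert_of_notMem hnot, Finset.card_image_of_injective _ hinj, Finset.card_univ, Fintype.card_fin] at h1
  rw [pow_succ] at hcount
  omega

/-- **Members of the half family containing the top state have at most `⌊n/2⌋` states.** -/
theorem card_le_of_mem_top (n : ℕ) (cols : Fin (2 ^ n) → Finset (Fin (n + 1))) (hinj : Function.Injective cols)
    (hgc : ∀ k J, J ∉ Set.range cols →
      ∑ q ∈ cols k, (2 ^ (n + 1) + 2 ^ (q : ℕ)) < ∑ q ∈ J, (2 ^ (n + 1) + 2 ^ (q : ℕ)))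
    (k : Fin (2 ^ n)) (hz : Fin.last n ∈ cols k) : (cols k).card ≤ n / 2 := by
  classical
  by_contra hbig
  push Not at hbig
  -- `c₀ = ⌊n/2⌋ + 1 = ⌈h/2⌉`
  set L : Finset (Finset (Fin (n + 1))) :=
    Finset.univ.filter fun J => J.card < n / 2 + 1 ∨ (J.card = n / 2 + 1 ∧ Fin.last n ∉ J) with hLdef
  have hL : ∀ J : Finset (Fin (n + 1)), J ∈ L ∨ Jᶜ ∈ L := by
    intro J
    simp only [hLdef, Finset.mem_filter, Finset.mem_univ, true_and, Finset.card_compl, Fintype.card_fin, Finset.mem_compl,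
      not_not]
    by_cases hzJ : Fin.last n ∈ J
    · simp only [hzJ, not_true_eq_false, and_false, or_false, and_true]; omega
    · simp only [hzJ, not_false_eq_true, and_true, and_false, or_false]; omega
  have hcount := two_pow_le_two_mul_card (n + 1) L hL
  have hsub : insert (cols k) L ⊆ Finset.univ.image cols := by
    intro J hJ
    rw [Finset.mem_insert] at hJ
    rcases hJ with rfl | hJ
    · exact Finset.mem_image.mpr ⟨k, Finset.mem_univ _, rfl⟩
    · have hJ' := (Finset.mem_filter.mp hJ).2
      have hlt : ∑ q ∈ J, (2 ^ (n + 1) + 2 ^ (q : ℕ)) < ∑ q ∈ cols k, (2 ^ (n + 1) + 2 ^ (q : ℕ)) := by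
        rcases hJ' with hJc | ⟨hJc, hJz⟩
        · exact gcw_lt_of_card_lt (n + 1) J (cols k) (by omega)
        · rcases Nat.lt_or_ge J.card (cols k).card with hlt | hge
          · exact gcw_lt_of_card_lt (n + 1) J (cols k) hlt
          · have heq : J.card = (cols k).card := by omega
            rw [gcw_eq, gcw_eq, heq]
            have h1 := binSum_lt_of_notMem_last n J hJz
            have h2 : 2 ^ n ≤ ∑ q ∈ cols k, 2 ^ (q : ℕ) := by
              have := Finset.single_le_sum (f := fun q : Fin (n + 1) => 2 ^ (q : ℕ)) (fun _ _ => Nat.zero_le _) hz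
              simpa using this
            omega
      obtain ⟨k', hk'⟩ := gc_mem_of_lt cols hgc k J hlt
      exact Finset.mem_image.mpr ⟨k', Finset.mem_univ _, hk'⟩
  have hnot : cols k ∉ L := by
    intro hk
    have := (Finset.mem_filter.mp hk).2
    rcases this with h1 | ⟨_, h2⟩
    · omega
    · exact h2 hz
  have h1 := Finset.card_le_card hsub
  rw [Finset.card_insert_of_notMem hnot, Finset.card_image_of_injective _ hinj, Finset.card_univ, Fintype.card_fin] at h1
  rw [pow_succ] at hcount
  omega

/-! ## 2. The antipodal support bijection -/

/-- **GC½ AT THE EXACT HALF SERVES THE SUBCUBE (every `h = n + 1`).** For ANY graded-colex family `cols` of `2^n` subsets of the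
`n + 1` states and ANY injective row family `u` of `2^n` subsets of `Fin (n+1)` avoiding a coordinate `x` (so `u` enumerates the subcube
`{S : x ∉ S}`), the antipodal table makes the one-piece hidden-point matrix nonsingular. -/
theorem gc_half_serves_subcube (n : ℕ) (cols : Fin (2 ^ n) → Finset (Fin (n + 1))) (hinj : Function.Injective cols)
    (hgc : ∀ k J, J ∉ Set.range cols →
      ∑ q ∈ cols k, (2 ^ (n + 1) + 2 ^ (q : ℕ)) < ∑ q ∈ J, (2 ^ (n + 1) + 2 ^ (q : ℕ)))
    (x : Fin (n + 1)) (u : Fin (2 ^ n) → Finset (Fin (n + 1))) (hu : Function.Injective u) (hux : ∀ i, x ∉ u i) :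
    ∃ tx : Option (Fin (n + 1)) → Fin (n + 1) → ℂ,
      (Matrix.of fun i k : Fin (2 ^ n) => ∏ a ∈ u i, (tx none a + ∑ q ∈ cols k, tx (some q) a)).det ≠ 0 := by
  classical
  set z : Fin (n + 1) := Fin.last n with hzdef
  set emb : Fin n ↪ Fin (n + 1) := Fin.succAboveEmb x with hemb
  -- the antipodal table: state `castSucc q'` ↦ `e_{succAbove x q'}`, state `z` ↦ `−Σ e`, base `0`
  let tab : Fin (n + 1) → Fin (n + 1) → ℂ :=
    fun q => Fin.lastCases (fun a => if a = x then 0 else -1) (fun q' a => if a = emb q' then 1 else 0) q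
  let tx : Option (Fin (n + 1)) → Fin (n + 1) → ℂ := fun o => Option.elim o (fun _ => 0) tab
  have htab_c : ∀ (q' : Fin n) a, tab (Fin.castSucc q') a = if a = emb q' then 1 else 0 := by
    intro q' a; simp only [tab, Fin.lastCases_castSucc]
  have htab_z : ∀ a, tab z a = if a = x then 0 else -1 := by
    intro a; simp only [tab, hzdef, Fin.lastCases_last]
  -- the pulled-back state set of a column
  let pre : Fin (2 ^ n) → Finset (Fin n) := fun k => Finset.univ.filter fun q' => Fin.castSucc q' ∈ cols k
  have hpre : ∀ k, (cols k).erase z = (pre k).map Fin.castSuccEmb := by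
    intro k; ext q
    simp only [Finset.mem_erase, Finset.mem_map, Finset.mem_filter, Finset.mem_univ, true_and, Fin.castSuccEmb_apply, pre]
    constructor
    · rintro ⟨hq, hqk⟩
      rcases Fin.eq_castSucc_or_eq_last q with ⟨q', rfl⟩ | rfl
      · exact ⟨q', hqk, rfl⟩
      · exact absurd rfl hq
    · rintro ⟨q', hq', rfl⟩
      exact ⟨(Fin.castSucc_lt_last q').ne, hq'⟩
  -- the coordinates of the hidden points
  have hpt_x : ∀ k, tx none x + ∑ q ∈ cols k, tx (some q) x = 0 := by
    intro k
    simp only [tx, Option.elim, zero_add]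
    refine Finset.sum_eq_zero fun q _ => ?_
    rcases Fin.eq_castSucc_or_eq_last q with ⟨q', rfl⟩ | rfl
    · rw [htab_c]; exact if_neg fun h => Fin.succAbove_ne x q' h.symm
    · rw [← hzdef, htab_z, if_pos rfl]
  have hpt : ∀ k (a' : Fin n), tx none (emb a') + ∑ q ∈ cols k, tx (some q) (emb a')
      = (if a' ∈ pre k then (1 : ℂ) else 0) - (if z ∈ cols k then 1 else 0) := by
    intro k a'
    simp only [tx, Option.elim, zero_add]
    have hcs : ∑ q ∈ (cols k).erase z, tab q (emb a') = if a' ∈ pre k then (1 : ℂ) else 0 := by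
      rw [hpre, Finset.sum_map]
      simp only [Fin.castSuccEmb_apply, htab_c]
      have : ∀ q' : Fin n, (if emb a' = emb q' then (1 : ℂ) else 0) = if a' = q' then 1 else 0 := by
        intro q'
        by_cases h : a' = q'
        · rw [if_pos h, if_pos (by rw [h])]
        · rw [if_neg h, if_neg (fun h' => h (emb.injective h'))]
      simp only [this, Finset.sum_ite_eq]
    by_cases hz : z ∈ cols k
    · rw [← Finset.add_sum_erase (cols k) (fun q => tab q (emb a')) hz, hcs, if_pos hz, htab_z,
        if_neg (show ¬ (emb a' = x) from Fin.succAbove_ne x a')]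
      ring
    · rw [← Finset.erase_eq_of_notMem hz, hcs, Finset.erase_eq_of_notMem hz, if_neg hz, sub_zero]
  -- the supports
  let T : Fin (2 ^ n) → Finset (Fin (n + 1)) :=
    fun k => if z ∈ cols k then (Finset.univ \ pre k).map emb else (pre k).map emb
  have hTx : ∀ k, x ∉ T k := by
    intro k hx
    by_cases hz : z ∈ cols k
    · simp only [T, hz, if_true, Finset.mem_map] at hx
      obtain ⟨a', -, ha'⟩ := hx; exact Fin.succAbove_ne x a' ha'
    · simp only [T, hz, if_false, Finset.mem_map] at hx
      obtain ⟨a', -, ha'⟩ := hx; exact Fin.succAbove_ne x a' ha'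
  have hTemb : ∀ k (a' : Fin n), emb a' ∈ T k ↔ (z ∈ cols k ∧ a' ∉ pre k) ∨ (z ∉ cols k ∧ a' ∈ pre k) := by
    intro k a'
    by_cases hz : z ∈ cols k
    · simp only [T, hz, if_true, Finset.mem_map' emb, Finset.mem_sdiff, Finset.mem_univ, true_and, not_true_eq_false,
        false_and, or_false]
    · simp only [T, hz, if_false, Finset.mem_map' emb, false_and, not_false_eq_true, true_and, false_or]
  have hT : ∀ k a, (tx none a + ∑ q ∈ cols k, tx (some q) a ≠ 0 ↔ a ∈ T k) := by
    intro k a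
    by_cases hax : a = x
    · subst hax
      rw [hpt_x]
      simp only [ne_eq, not_true_eq_false, false_iff]
      exact hTx k
    · obtain ⟨a', rfl⟩ := Fin.exists_succAbove_eq hax
      change tx none (emb a') + ∑ q ∈ cols k, tx (some q) (emb a') ≠ 0 ↔ emb a' ∈ T k
      rw [hpt, hTemb]
      by_cases hz : z ∈ cols k <;> by_cases ha : a' ∈ pre k <;> simp [hz, ha]
  -- sizes
  have hpre_card : ∀ k, (pre k).card + (if z ∈ cols k then 1 else 0) = (cols k).card := by
    intro k
    have h1 : ((cols k).erase z).card = (pre k).card := by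
      rw [hpre, Finset.card_map]
    by_cases hz : z ∈ cols k
    · rw [if_pos hz, ← h1, Finset.card_erase_add_one hz]
    · rw [if_neg hz, add_zero, ← h1, Finset.erase_eq_of_notMem hz]
  have hTinj : Function.Injective T := by
    intro k k' hkk
    by_cases hz : z ∈ cols k <;> by_cases hz' : z ∈ cols k'
    · -- both contain `z`
      have h1 : (Finset.univ \ pre k).map emb = (Finset.univ \ pre k').map emb := by
        simpa only [T, hz, hz', if_true] using hkk
      have h2 : pre k = pre k' := by
        have := Finset.map_injective emb h1
        rwa [← Finset.compl_eq_univ_sdiff, ← Finset.compl_eq_univ_sdiff, compl_inj_iff] at this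
      apply hinj
      rw [← Finset.insert_erase hz, ← Finset.insert_erase hz', hpre, hpre, h2]
    · exfalso
      have hc : ((Finset.univ \ pre k).map emb).card = ((pre k').map emb).card := by
        have : T k = T k' := hkk
        simp only [T, hz, hz', if_true, if_false] at this
        rw [this]
      rw [Finset.card_map, Finset.card_map, Finset.card_sdiff_of_subset (Finset.subset_univ _), Finset.card_univ, Fintype.card_fin] at hc
      have h1 := card_le_of_mem_top n cols hinj hgc k hz
      have h2 := card_le_of_mem n cols hinj hgc k'
      have h3 := hpre_card k; have h4 := hpre_card k'
      rw [if_pos hz] at h3; rw [if_neg hz'] at h4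
      omega
    · exfalso
      have hc : ((pre k).map emb).card = ((Finset.univ \ pre k').map emb).card := by
        have : T k = T k' := hkk
        simp only [T, hz, hz', if_true, if_false] at this
        rw [this]
      rw [Finset.card_map, Finset.card_map, Finset.card_sdiff_of_subset (Finset.subset_univ _), Finset.card_univ, Fintype.card_fin] at hc
      have h1 := card_le_of_mem n cols hinj hgc k
      have h2 := card_le_of_mem_top n cols hinj hgc k' hz'
      have h3 := hpre_card k; have h4 := hpre_card k'
      rw [if_neg hz] at h3; rw [if_pos hz'] at h4
      omega
    · -- both avoid `z`
      have h1 : (pre k).map emb = (pre k').map emb := by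
        simpa only [T, hz, hz', if_false] using hkk
      have h2 : pre k = pre k' := Finset.map_injective emb h1
      apply hinj
      rw [← Finset.erase_eq_of_notMem hz, ← Finset.erase_eq_of_notMem hz', hpre, hpre, h2]
  -- the rows are exactly the subsets avoiding `x`
  have himg : Finset.univ.image u = (Finset.univ.erase x).powerset := by
    apply Finset.eq_of_subset_of_card_le
    · intro S hS
      obtain ⟨i, -, rfl⟩ := Finset.mem_image.mp hS
      rw [Finset.mem_powerset, Finset.subset_erase]
      exact ⟨Finset.subset_univ _, hux i⟩
    · rw [Finset.card_powerset, Finset.card_erase_of_mem (Finset.mem_univ x), Finset.card_univ, Fintype.card_fin,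
        Finset.card_image_of_injective _ hu, Finset.card_univ, Fintype.card_fin]
      simp
  have hTu : ∀ k, ∃ i, u i = T k := by
    intro k
    have : T k ∈ (Finset.univ.erase x).powerset := by
      rw [Finset.mem_powerset, Finset.subset_erase]
      exact ⟨Finset.subset_univ _, hTx k⟩
    rw [← himg] at this
    obtain ⟨i, -, hi⟩ := Finset.mem_image.mp this
    exact ⟨i, hi⟩
  refine ⟨tx, ?_⟩
  have := SymbJoin.det_ne_zero_of_supports (m := 1) u (fun k => ((0 : Fin 1), cols k)) (fun _ => tx) T
    (fun k a => hT k a) hTinj hTu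
  simpa using this

/-- **The GC½ hypothesis at `r = 2^{h−1}` for the subcube, in the binder shape of
`BallDiag.universalJoinWideLower_upperHalf_of_gc`** (`h ≥ 1`; the row family is ANY injective `u` of `2^{h−1}` sets avoiding some
coordinate — lowerness is automatic and not needed). -/
theorem gc_hypothesis_half_subcube (h : ℕ) (h1 : 1 ≤ h) (cols : Fin (2 ^ (h - 1)) → Finset (Fin h))
    (hinj : Function.Injective cols)
    (hgc : ∀ k J, J ∉ Set.range cols → ∑ q ∈ cols k, (2 ^ h + 2 ^ (q : ℕ)) < ∑ q ∈ J, (2 ^ h + 2 ^ (q : ℕ)))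
    (x : Fin h) (u : Fin (2 ^ (h - 1)) → Finset (Fin h)) (hu : Function.Injective u) (hux : ∀ i, x ∉ u i) :
    ∃ tx : Option (Fin h) → Fin h → ℂ,
      (Matrix.of fun i k : Fin (2 ^ (h - 1)) => ∏ a ∈ u i, (tx none a + ∑ q ∈ cols k, tx (some q) a)).det ≠ 0 := by
  obtain ⟨n, rfl⟩ : ∃ n, h = n + 1 := ⟨h - 1, by omega⟩
  have hn : n + 1 - 1 = n := by omega
  revert cols u
  rw [hn]
  intro cols hinj hgc u hu hux
  exact gc_half_serves_subcube n cols hinj hgc x u hu hux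

end BallDiag

end

end Summit.ValiantsHypothesis.ValiantsHypothesis.Theorems.BarrierLever.HiddenStates
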